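import Summits.HodgeConjecture.HodgeConjecture.Theorems.PadicSemiregularLiftHodgeFermatVarietiesStubClaimLevelPull
import Literature.AlgebraicGeometry.HodgeTheory.FermatLevelMap
import Literature.AlgebraicGeometry.HodgeTheory.HypersurfaceLefschetzUpper
import Literature.AlgebraicGeometry.HodgeTheory.ComplexOrientationDegreeEtaleLocus
import Literature.AlgebraicGeometry.HodgeTheory.FermatHodgeConjectureProofs
import Mathlib.Analysis.Calculus.InverseFunctionTheorem.FDeriv
import Mathlib.Analysis.Calculus.Deriv.Pow
import Mathlib.RingTheory.RootsOfUnity.Complex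
import HarnessLib

/-!
# `stub_claimLevelPush` holds: claim pushes forward along the level map `[xᵢ] ↦ [xᵢᵏ]` — line `cancel-by-any-claim-lattice`, crux `HodgeFermatVarieties` (stmt-HodgeConjecture-1334)

Proof file (`--supports stmt-HodgeConjecture-1334`) of the stub `stub_claimLevelPush` (S2↓) of the
skeleton of line `cancel-by-any-claim-lattice`, UNCONDITIONALLY: for `k ≥ 1` and a zero-free
character `α'` of level `m`, claim_{km}(k • α') ⟹ claim_m(α') (Shioda–Katsura, Tôhoku Math. J. 31
(1979) §1; Aoki, J. Math. Soc. Japan 39 (1987) p. 387 and Cor. 2-3).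

The sibling file `…StubClaimLevelPush` reduced the stub (`stub_claimLevelPush_of_map_top_ne_zero`)
to a morphism `π : X²ʳ_{km} ⟶ X²ʳₘ` of the standard models with (M2) `π^* V_m(α') ⊆ V_{km}(k • α')`
and (M5′) `π^* ≠ 0` on the top cohomology `H⁴ʳ(X²ʳₘ(ℂ); ℂ)`. The level map
`π = fermatLevelMap (2r) hk hm` of `HodgeTheory/FermatLevelMap` (the power map `projPowerMap` of
`ℙ²ʳ⁺¹_ℂ` restricted to the Fermat hypersurfaces) supplies the morphism and, through its points
formula `[z] ↦ [zᵢᵏ]` and `map_mem_fermatEigenspace_of_levelMap` (`…StubClaimLevelPull`), (M2).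
This file proves (M5′) and assembles (no definitions; the affine chart point `[1 : w]` is written
`projPoint (n + 1) (stdChartInv 0 w)` throughout):

* `hasDegree_projPowerMap` — **the power map `P : [x] ↦ [xᵏ]` of `ℙⁿ⁺¹_ℂ` has degree `kⁿ⁺¹` for
  the complex orientations**: the fibre of `P(ℂ)` over `[1 : 1 : ⋯ : 1]` is the set of the `kⁿ⁺¹`
  points `[1 : η₁ : ⋯ : η_{n+1}]`, `ηⱼ ∈ μ_k` (`preimage_projPowerMap_one`), at each of which
  `P(ℂ)` is a local homeomorphism — on the affine chart `{x₀ ≠ 0} ≅ ℂⁿ⁺¹` it is `w ↦ (wⱼᵏ)ⱼ`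
  (`map_projPowerMap_stdChartInv`), whose derivative `diag(k wⱼᵏ⁻¹)` is invertible off the
  coordinate hyperplanes (inverse function theorem, Mathlib `HasStrictFDerivAt.toOpenPartialHomeomorph`;
  `exists_chart_projPowerMap`) — so `P(ℂ)_* [ℙⁿ⁺¹(ℂ)] = kⁿ⁺¹ • [ℙⁿ⁺¹(ℂ)]` by the tree's
  degree-over-a-finite-good-fibre theorem `map_fundamentalClass_complexOrientationFamily_of_finite_fibre`
  (Hatcher Prop. 2.30: every sheet of a holomorphic local homeomorphism counts `+1`);
* `map_projPowerMap_injective` — hence **`P^*` is injective on `H*(ℙⁿ⁺¹(ℂ); ℂ)`**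
  (`P_* P^* = kⁿ⁺¹ •`, `complexGysin_map_of_hasDegree`);
* `exists_map_fermatLevelMap_top_ne_zero` — **(M5′): `π^* ≠ 0` on `H²ⁿ(Xⁿₘ(ℂ); ℂ)`** (`n ≥ 1`):
  for `γ ≠ 0` in the line `H²ⁿ(ℙⁿ⁺¹(ℂ); ℂ)`, `π^* (ι_m^* γ) = ι_{km}^* (P^* γ)`
  (`fermatLevelMap_comp_ι`) and the restriction of the non-zero class `P^* γ` to the smooth
  hypersurface `Xⁿ_{km}` is non-zero (`map_ne_zero_of_le`, the degree of a smooth hypersurface);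
* `stub_claimLevelPush` — **S2↓, the registered statement**, by `stub_claimLevelPush_of_map_top_ne_zero`.

Everything is proved; no named facts, no hypotheses.

## References

* [ShiodaKatsura1979] T. Shioda, T. Katsura, On Fermat varieties, Tôhoku Math. J. 31 (1979), §1.
* [Aoki1987] N. Aoki, Some new algebraic cycles on Fermat varieties, J. Math. Soc. Japan 39 (1987),
  §1 p. 387 and Cor. 2-3.
* [Hartshorne1977] R. Hartshorne, Algebraic Geometry, GTM 52 (1977), II Ex. 2.14.
* [HatcherAT2002] A. Hatcher, Algebraic Topology, CUP 2002, §2.2 Prop. 2.30, §3.3 Thm. 3.26.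
* [FultonYoungTableaux1997] W. Fulton, Young Tableaux, CUP 1997, App. B §B.1 (5)–(7).
* [VoisinHodgeII2003] C. Voisin, Hodge Theory and Complex Algebraic Geometry II, §1.2.3 Cor. 1.25.
-/

set_option linter.dupNamespace false

noncomputable section

open CategoryTheory AlgebraicGeometry Finset
open Literature.AlgebraicGeometry Literature.AlgebraicGeometry.Motives
open Literature.AlgebraicGeometry.HodgeTheory Literature.AlgebraicGeometry.HodgeTheory.FermatCharacter
open Literature.AlgebraicTopology.SingularHomology
open Literature.NumberTheory.Transcendental Projectivization

namespace Summit.HodgeConjecture.HodgeConjecture.Theorems.CancelByAnyClaimLattice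

/-! ### The power map of `ℙⁿ⁺¹_ℂ` on the affine chart `{x₀ ≠ 0}` -/

section PowerMap

variable {n k : ℕ}

/-- **`w ↦ [1 : w]` is an open embedding `ℂⁿ⁺¹ ↪ ℙⁿ⁺¹(ℂ)`** (`projPoint` is a homeomorphism, GAGA
§2 n°5; the standard chart `{x₀ ≠ 0}` is an open partial homeomorphism with target `ℂⁿ⁺¹`).
[folklore] -/
theorem isOpenEmbedding_projPoint_stdChartInv :
    Topology.IsOpenEmbedding fun w : Fin (n + 1) → ℂ ↦ projPoint (n + 1) (stdChartInv 0 w) :=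
  (isHomeomorph_projPoint (n + 1)).isOpenEmbedding.comp
    ((stdChart (𝕜 := ℂ) (n := n + 1) 0).symm.to_isOpenEmbedding (by
      rw [OpenPartialHomeomorph.symm_source, stdChart_target]))

/-- `(1, w)ᵏ = (1, wᵏ)` coordinatewise. [folklore] -/
theorem insertNth_pow (w : Fin (n + 1) → ℂ) :
    (fun i ↦ Fin.insertNth (0 : Fin (n + 2)) (1 : ℂ) w i ^ k) =
      Fin.insertNth 0 (1 : ℂ) (fun j ↦ w j ^ k) := by
  funext i
  rw [Fin.insertNth_zero', Fin.insertNth_zero']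
  refine Fin.cases ?_ (fun j ↦ ?_) i
  · simp
  · simp

/-- **The power map on the affine chart: `P [1 : w] = [1 : (wⱼᵏ)ⱼ]`** (the points formula
`map_projPowerMap_projPoint`). [cite: Hartshorne1977, II Ex. 2.14] -/
theorem map_projPowerMap_stdChartInv (hk : 0 < k) (w : Fin (n + 1) → ℂ) :
    AlgPoints.map (projPowerMap n hk) (projPoint (n + 1) (stdChartInv 0 w)) =
      projPoint (n + 1) (stdChartInv 0 fun j ↦ w j ^ k) := by
  simp only [stdChartInv]
  rw [map_projPowerMap_projPoint hk]
  congr 2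
  exact insertNth_pow w

/-- `[1 : 1 : ⋯ : 1]` (the chart point of `w = 1`) has all homogeneous coordinates `1`. [folklore] -/
theorem projPoint_stdChartInv_one :
    projPoint (n + 1) (stdChartInv 0 (1 : Fin (n + 1) → ℂ)) = projPoint (n + 1) (mk ℂ 1 one_ne_zero) := by
  simp only [stdChartInv]
  congr 2
  funext i
  rw [Fin.insertNth_zero']
  refine Fin.cases ?_ (fun j ↦ ?_) i
  · simp
  · simp

/-! ### The power map is a local homeomorphism off the coordinate hyperplanes -/

/-- **The derivative of `w ↦ (wⱼᵏ)ⱼ` at `w` is `diag(k wⱼᵏ⁻¹)`** (strict differentiability,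
coordinate by coordinate). [folklore] -/
theorem hasStrictFDerivAt_vecPow (w : Fin (n + 1) → ℂ) :
    HasStrictFDerivAt (fun x : Fin (n + 1) → ℂ ↦ fun j ↦ x j ^ k)
      (ContinuousLinearMap.pi fun j ↦
        ((k : ℂ) * w j ^ (k - 1)) • (ContinuousLinearMap.proj j : (Fin (n + 1) → ℂ) →L[ℂ] ℂ)) w :=
  hasStrictFDerivAt_pi.2 fun j ↦
    (hasStrictDerivAt_pow k (w j)).comp_hasStrictFDerivAt w (hasStrictFDerivAt_apply j w)

/-- **`P(ℂ)` is a local homeomorphism at `[1 : w]` when all `wⱼ ≠ 0`**: there is an open partial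
homeomorphism of `ℙⁿ⁺¹(ℂ)` through `[1 : w]` whose total function is `P(ℂ)`. On the chart
`{x₀ ≠ 0} ≅ ℂⁿ⁺¹`, `P(ℂ)` is `w ↦ (wⱼᵏ)ⱼ` with invertible derivative `diag(k wⱼᵏ⁻¹)`; the inverse
function theorem gives a local inverse, which is transported along the open embedding `w ↦ [1 : w]`
(`exists_openPartialHomeomorph_extend`). [cite: HatcherAT2002, §2.2 Prop. 2.30] -/
theorem exists_chart_projPowerMap (hk : 0 < k) (w : Fin (n + 1) → ℂ) (hw : ∀ j, w j ≠ 0) :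
    ∃ e : OpenPartialHomeomorph (ComplexPoints (projectiveSpace (n + 1) ℂ))
        (ComplexPoints (projectiveSpace (n + 1) ℂ)),
      projPoint (n + 1) (stdChartInv 0 w) ∈ e.source ∧ (e : _ → _) = AlgPoints.map (projPowerMap n hk) := by
  set c : Fin (n + 1) → ℂ := fun j ↦ (k : ℂ) * w j ^ (k - 1) with hcdef
  have hc0 : ∀ j, c j ≠ 0 := fun j ↦ mul_ne_zero (Nat.cast_ne_zero.2 hk.ne') (pow_ne_zero _ (hw j))
  -- the derivative `diag(c)` as a continuous linear automorphism of `ℂⁿ⁺¹`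
  let D : (Fin (n + 1) → ℂ) ≃L[ℂ] (Fin (n + 1) → ℂ) :=
    ContinuousLinearEquiv.equivOfInverse
      (ContinuousLinearMap.pi fun j ↦ c j • (ContinuousLinearMap.proj j : (Fin (n + 1) → ℂ) →L[ℂ] ℂ))
      (ContinuousLinearMap.pi fun j ↦ (c j)⁻¹ • (ContinuousLinearMap.proj j : (Fin (n + 1) → ℂ) →L[ℂ] ℂ))
      (fun h ↦ funext fun j ↦ by simp [inv_mul_cancel_left₀ (hc0 j)])
      (fun h ↦ funext fun j ↦ by simp [mul_inv_cancel_left₀ (hc0 j)])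
  have hD : HasStrictFDerivAt (fun x : Fin (n + 1) → ℂ ↦ fun j ↦ x j ^ k)
      (D : (Fin (n + 1) → ℂ) →L[ℂ] (Fin (n + 1) → ℂ)) w :=
    hasStrictFDerivAt_vecPow w
  haveI : Nonempty (Fin (n + 1) → ℂ) := ⟨0⟩
  set e' := (hD.toOpenPartialHomeomorph _).trans
    (isOpenEmbedding_projPoint_stdChartInv.toOpenPartialHomeomorph
      fun w : Fin (n + 1) → ℂ ↦ projPoint (n + 1) (stdChartInv 0 w)) with he'def
  have he' : (e' : _ → _) =
      AlgPoints.map (projPowerMap n hk) ∘ fun w : Fin (n + 1) → ℂ ↦ projPoint (n + 1) (stdChartInv 0 w) := by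
    funext x
    rw [he'def, OpenPartialHomeomorph.coe_trans, Function.comp_apply, Function.comp_apply,
      Topology.IsOpenEmbedding.toOpenPartialHomeomorph_apply,
      HasStrictFDerivAt.toOpenPartialHomeomorph_coe, map_projPowerMap_stdChartInv]
  have hy : w ∈ e'.source := by
    rw [he'def, OpenPartialHomeomorph.trans_source,
      Topology.IsOpenEmbedding.toOpenPartialHomeomorph_source, Set.preimage_univ, Set.inter_univ]
    exact hD.mem_toOpenPartialHomeomorph_source
  exact exists_openPartialHomeomorph_extend (AlgPoints.continuous_map (projPowerMap n hk))
    isOpenEmbedding_projPoint_stdChartInv e' he' hy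

/-! ### The fibre of the power map over `[1 : ⋯ : 1]` and its degree -/

/-- **The fibre of `P(ℂ)` over `[1 : ⋯ : 1]` is `{[1 : η₁ : ⋯ : η_{n+1}] : ηⱼ ∈ μ_k}`**, indexed by
`(μ_k)ⁿ⁺¹`: if `[vᵏ] = [1 : ⋯ : 1]` then all `vᵢᵏ` are equal and non-zero, so `v₀ ≠ 0` and
`[v] = [1 : w]` with `wⱼ = v_{j+1}/v₀`, `wⱼᵏ = 1`. [cite: Hartshorne1977, II Ex. 2.14] -/
theorem preimage_projPowerMap_one [NeZero k] (hk : 0 < k) :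
    AlgPoints.map (projPowerMap n hk) ⁻¹' {projPoint (n + 1) (stdChartInv 0 (1 : Fin (n + 1) → ℂ))} =
      Set.range fun η : Fin (n + 1) → rootsOfUnity k ℂ ↦
        projPoint (n + 1) (stdChartInv 0 fun j ↦ ((η j : ℂˣ) : ℂ)) := by
  ext Q
  simp only [Set.mem_preimage, Set.mem_singleton_iff, Set.mem_range]
  constructor
  · intro hQ
    obtain ⟨p, rfl⟩ := projPoint_surjective (n + 1) Q
    induction p using Projectivization.ind with
    | h v hv =>
    rw [map_projPowerMap_projPoint hk, projPoint_stdChartInv_one] at hQ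
    obtain ⟨a, ha⟩ := (mk_eq_mk_iff ℂ _ _ _ _).1 (projPoint_injective (n + 1) hQ)
    have hva : ∀ i, v i ^ k = (a : ℂ) := fun i ↦ by
      have h := congrFun ha i
      simp only [Pi.smul_apply, Pi.one_apply, Units.smul_def, smul_eq_mul, mul_one] at h
      exact h.symm
    have hv0 : v 0 ≠ 0 := fun h0 ↦ a.ne_zero (by rw [← hva 0, h0, zero_pow hk.ne'])
    have hmem : mk ℂ v hv ∈ stdChartSource 0 := (mk_mem_stdChartSource_iff 0 v hv).2 hv0
    have hw : ∀ j, stdChartFun 0 (mk ℂ v hv) j ^ k = 1 := fun j ↦ by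
      rw [stdChartFun_mk, div_pow, hva, hva, div_self a.ne_zero]
    refine ⟨fun j ↦ rootsOfUnity.mkOfPowEq _ (hw j), ?_⟩
    have hcoe : (fun j ↦ (((rootsOfUnity.mkOfPowEq _ (hw j) : rootsOfUnity k ℂ) : ℂˣ) : ℂ)) =
        stdChartFun 0 (mk ℂ v hv) :=
      funext fun j ↦ rootsOfUnity.coe_mkOfPowEq (hw j)
    rw [hcoe, stdChartInv_stdChartFun 0 hmem]
  · rintro ⟨η, rfl⟩
    rw [map_projPowerMap_stdChartInv]
    congr 2
    exact funext fun j ↦ (mem_rootsOfUnity' k _).1 (η j).2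

/-- **The power map `[x] ↦ [xᵏ]` of `ℙⁿ⁺¹_ℂ` (`k ≥ 1`) has degree `kⁿ⁺¹` for the complex
orientations**: `P(ℂ)_* [ℙⁿ⁺¹(ℂ)] = kⁿ⁺¹ • [ℙⁿ⁺¹(ℂ)]` — the degree read off the finite good fibre
over `[1 : ⋯ : 1]` (`#(μ_k)ⁿ⁺¹ = kⁿ⁺¹` points `[1 : η]`, pairwise distinct since `w ↦ [1 : w]` is
injective, each a local homeomorphism point of the holomorphic `P(ℂ)`, hence of local degree `+1`:
the tree's `map_fundamentalClass_complexOrientationFamily_of_finite_fibre`).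
[cite: HatcherAT2002, §2.2 Prop. 2.30] [cite: Hartshorne1977, II Ex. 2.14] -/
theorem hasDegree_projPowerMap (hk : 0 < k) :
    HasDegree (complexOrientationFamily (isSmoothProjective_projectiveSpace_holds ℂ (n + 1)))
      (complexOrientationFamily (isSmoothProjective_projectiveSpace_holds ℂ (n + 1)))
      (AlgPoints.mapContinuous (L := ℂ) (projPowerMap n hk)) ((k : ℤ) ^ (n + 1)) := by
  haveI : NeZero k := ⟨hk.ne'⟩
  haveI : Fintype (rootsOfUnity k ℂ) := Fintype.ofFinite _
  have hP : IsSmoothProjective (n + 1) (projectiveSpace (n + 1) ℂ) :=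
    isSmoothProjective_projectiveSpace_holds ℂ (n + 1)
  have hinj : Function.Injective fun η : Fin (n + 1) → rootsOfUnity k ℂ ↦
      projPoint (n + 1) (stdChartInv 0 fun j ↦ ((η j : ℂˣ) : ℂ)) := fun η η' h ↦
    funext fun j ↦ Subtype.ext (Units.ext (congrFun (isOpenEmbedding_projPoint_stdChartInv.injective h) j))
  have h := map_fundamentalClass_complexOrientationFamily_of_finite_fibre hP hP (projPowerMap n hk)
    hinj (preimage_projPowerMap_one hk)
    (fun η ↦ exists_chart_projPowerMap hk (fun j ↦ ((η j : ℂˣ) : ℂ)) fun j ↦ (η j : ℂˣ).ne_zero)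
  have hcard : Fintype.card (Fin (n + 1) → rootsOfUnity k ℂ) = k ^ (n + 1) := by
    rw [Fintype.card_fun, Fintype.card_fin, ← Nat.card_eq_fintype_card, Complex.card_rootsOfUnity]
  rw [HasDegree, h, hcard, Nat.cast_smul_eq_nsmul, ← natCast_zsmul, Nat.cast_pow]

/-- **`P^*` is injective on `H*(ℙⁿ⁺¹(ℂ); ℂ)`** for the power map `P : [x] ↦ [xᵏ]`, `k ≥ 1`:
`P_* (P^* x) = kⁿ⁺¹ • x` (projection formula with `P_* 1 = deg P • 1`,
`complexGysin_map_of_hasDegree`) and `kⁿ⁺¹ ≠ 0`.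
[cite: FultonYoungTableaux1997, Appendix B §B.1 (6)–(7)] [cite: HatcherAT2002, §2.2 Prop. 2.30] -/
theorem map_projPowerMap_injective (hk : 0 < k) (a : ℕ) :
    Function.Injective (complexBetti.map (projPowerMap n hk) a).hom := by
  have hP : IsSmoothProjective (n + 1) (projectiveSpace (n + 1) ℂ) :=
    isSmoothProjective_projectiveSpace_holds ℂ (n + 1)
  rw [injective_iff_map_eq_zero]
  intro x hx
  have h := complexGysin_map_of_hasDegree complexOrientationFamily hP hP (projPowerMap n hk)
    (hasDegree_projPowerMap hk) x
  have hx' : (complexBetti.map (projPowerMap n hk) a) x = 0 := hx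
  rw [hx', LinearMap.map_zero, ← Int.cast_smul_eq_zsmul ℂ] at h
  exact (smul_eq_zero.1 h.symm).resolve_left (by exact_mod_cast pow_ne_zero (n + 1) hk.ne')

end PowerMap

/-! ### (M5′) for the level map and the stub -/

section LevelPush

variable {n m k : ℕ}

/-- **(M5′): `π^*` is non-zero on the top cohomology `H²ⁿ(Xⁿₘ(ℂ); ℂ)`** for the level map
`π = fermatLevelMap n hk hm : Xⁿ_{km} ⟶ Xⁿₘ`, `n, k, m ≥ 1`. For `γ ≠ 0` in the line
`H²ⁿ(ℙⁿ⁺¹(ℂ); ℂ)` and `ω = ι_m^* γ`: `π^* ω = ι_{km}^* (P^* γ)` (`π ≫ ι_m = ι_{km} ≫ P`,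
`fermatLevelMap_comp_ι`), `P^* γ ≠ 0` (`map_projPowerMap_injective`), and a non-zero class of
`H²ⁿ(ℙⁿ⁺¹(ℂ))` restricts non-trivially to the smooth hypersurface `Xⁿ_{km}` of dimension `n`
(its degree is non-zero: `map_ne_zero_of_le`). In print: `π^* [pt] = k^{n+1} [pt]`.
[cite: ShiodaKatsura1979, §1] [cite: VoisinHodgeII2003, §1.2.3 Cor. 1.25] -/
theorem exists_map_fermatLevelMap_top_ne_zero (hn : 1 ≤ n) (hk : 0 < k) (hm : 0 < m) :
    ∃ ω : complexBetti (fermatHypersurface n m) (2 * n),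
      complexBetti.map (fermatLevelMap n hk hm) (2 * n) ω ≠ 0 := by
  have hkm : 1 ≤ k * m := Nat.mul_pos hk hm
  have hY : IsSmoothProjective n (fermatHypersurface n (k * m)) :=
    isSmoothProjective_fermatHypersurface hn hkm
  -- a non-zero class of the line `H²ⁿ(ℙⁿ⁺¹(ℂ); ℂ)`
  obtain ⟨γ, hγ⟩ : ∃ γ : complexBetti (projectiveSpace (n + 1) ℂ) (2 * n), γ ≠ 0 := by
    have h1 := finrank_complexBetti_projectiveSpace_two_mul (n + 1) (k := n) (by omega)
    by_contra hcon
    push Not at hcon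
    haveI : Subsingleton (complexBetti (projectiveSpace (n + 1) ℂ) (2 * n)) :=
      ⟨fun a b ↦ by rw [hcon a, hcon b]⟩
    have : Module.finrank ℂ (complexBetti (projectiveSpace (n + 1) ℂ) (2 * n)) = 0 :=
      Module.finrank_zero_of_subsingleton
    omega
  refine ⟨complexBetti.map (SmoothHypersurface.hypersurfaceι (fermatPolynomial ℂ n m)) (2 * n) γ, ?_⟩
  have key : complexBetti.map (fermatLevelMap n hk hm) (2 * n)
      (complexBetti.map (SmoothHypersurface.hypersurfaceι (fermatPolynomial ℂ n m)) (2 * n) γ) =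
      complexBetti.map (SmoothHypersurface.hypersurfaceι (fermatPolynomial ℂ n (k * m))) (2 * n)
        (complexBetti.map (projPowerMap n hk) (2 * n) γ) := by
    rw [← ConcreteCategory.comp_apply, ← ConcreteCategory.comp_apply, ← complexBetti.map_comp,
      ← complexBetti.map_comp, fermatLevelMap_comp_ι]
  rw [key]
  exact map_ne_zero_of_le hY (isHomogeneous_fermatPolynomial n (k * m))
    (irreducible_fermatPolynomial_of_isAlgClosed (k := ℂ) hn hkm) inferInstance
    (SmoothHypersurface.hypersurfaceι (fermatPolynomial ℂ n (k * m)))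
    (SmoothHypersurface.range_hypersurfaceι _) le_rfl
    fun h0 ↦ hγ (map_projPowerMap_injective hk (2 * n) (by rw [h0]; exact (map_zero _).symm))

/-- **S2↓ `stub_claimLevelPush` (registered statement, unconditional): claim pushes forward along
the level map** — for `k ≥ 1` and a zero-free character `α'` of level `m`,
claim_{km}(k • α') ⟹ claim_m(α'). The level map `π = fermatLevelMap (2r) : X²ʳ_{km} ⟶ X²ʳₘ`,
`[xᵢ] ↦ [xᵢᵏ]`, satisfies (M2) `π^* V_m(α') ⊆ V_{km}(k • α')` (its points formula
`exists_rep_hypersurfacePoint_map_fermatLevelMap` and `map_mem_fermatEigenspace_of_levelMap`) and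
(M5′) `π^* ≠ 0` on `H⁴ʳ(X²ʳₘ(ℂ); ℂ)` (`exists_map_fermatLevelMap_top_ne_zero`), whence the push-pull
scalar `c` with `π_* π^* = c •` is non-zero and `V_m(α') ∋ x = c⁻¹ π_* π^* x ∈ π_*(Alg) ⊆ Alg`
(`stub_claimLevelPush_of_map_top_ne_zero`; degenerate cases `r = 0`, `m = 0` inside).
[cite: Aoki1987, §1 p. 387 and Cor. 2-3 (p. 388)] [cite: ShiodaKatsura1979, §1]
[cite: FultonYoungTableaux1997, Appendix B §B.1 (5)–(7) and §B.2 Exercise 5] -/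
theorem stub_claimLevelPush : ∀ (m k r : ℕ) (α' : Fin (2 * r + 2) → ZMod m), 0 < k → (∀ i, α' i ≠ 0) → FermatCharacter.Claim (k * m) r (fun i => ((k * (α' i).val : ℕ) : ZMod (k * m))) → FermatCharacter.Claim m r α' :=
  stub_claimLevelPush_of_map_top_ne_zero fun m k r hm hk hr ↦
    haveI : NeZero m := ⟨Nat.one_le_iff_ne_zero.mp hm⟩
    ⟨fermatLevelMap (2 * r) hk hm, exists_map_fermatLevelMap_top_ne_zero (n := 2 * r) (by omega) hk hm,
      fun _ _ _ hx ↦ map_mem_fermatEigenspace_of_levelMap hk (fermatLevelMap (2 * r) hk hm)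
        (exists_rep_hypersurfacePoint_map_fermatLevelMap hk hm) hx⟩

end LevelPush

end Summit.HodgeConjecture.HodgeConjecture.Theorems.CancelByAnyClaimLattice

end
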